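import Literature.NumberTheory.EllipticCurves.PadicSigmaVeluKernelBridgeProofs
import Literature.NumberTheory.EllipticCurves.PadicSigmaThreeChart
import HarnessLib

/-!
# The formal `3`-isogeny of the ordinary `a₂`-family: bridge lemmas for `a₁ = a₃ = 0` models (the
# `a₂`-term kept), the parameter `T ≡ t³`, the unit series `u ≡ 1`, `X'(T) = ev₃(U)·u²`,
# `ω'(T)dT = πω`, and Blakestad–Grant's Prop. 13 hypothesis in `ρ`-form

Trunk T-NT-EC (Literature/NumberTheory/EllipticCurves). Sequel of `PadicSigmaThreeChart.lean`.
Part `PadicSigmaThreeFormalIsogeny` (pure proofs, any `a₁ = a₃ = 0` model `W` over a ring `𝒪`): the tree's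
`PadicSigmaVeluKernelBridgeProofs` (`sq_velu_image`, `formalEta_mul_velu_image`) and
`VeluKernelReductionProofs` (`map_veluFormalUnit_sub_one`, `map_veluFormalIsog_sub`) turn POLYNOMIAL data of
a Vélu `p`-isogeny (`φ`, `U`, `M`; `f·M² = U³ + A₀Uφ⁴ + B₀φ⁶`, `U'φ - 2Uφ' = pM`, `U ≡ Xᵖ`, `M ≡ fⁿ`,
`φ ≡ ℓ₀`) into the POWER-SERIES data the analytic criterion `coeff_exp_sigmaExpArg_mem_of_isogeny` consumes,
but are stated for SHORT models; here the four lemmas are re-proved with the `a₂`-term in the target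
equation: `sq_velu_image_of_isCharNeTwoNF` (`P² = P³ + A₂·t_p²·P² + A₀·t_p⁴·P + B₀·t_p⁶`, `P = 𝒰u²`,
`t_p = tΦu`), `formalEta_mul_velu_image_scaled` (`η·(TP^• - 2PT^•) = -2(pc)P` for `T = c·t_p`),
`map_veluFormalUnit_sub_one_of_isCharNeTwoNF`, `map_veluFormalIsog_sub_of_isCharNeTwoNF` (`u ≡ 1`,
`t_p ≡ ℓ₀tᵖ (mod p)`).
Part `PadicSigmaThreeFormalIsogenyChart` (for a chart `d : Chart R` with `(φ, U, M) = (kernelPoly, xNum,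
yNum)`): the two power series of Blakestad–Grant's Lemma 12 — `unitSeries = u = 𝒰/(Xℳ)` (the tree's
`veluFormalUnit U M 3 1`) and `isogParam = T = t'∘ψ = ℓ₀⁻¹·t·Φ·u`, `ℓ₀ = φ(0) = -Y` — and: over ANY ring
`T(0) = 0`, `[t¹]T = π`, `T ≡ t³ (mod 3)` (`coeff_isogParam_sub_mem`), `u(0) = 1`, `[t¹]u = 0`,
`u ≡ 1 (mod 3)` (`coeff_succ_unitSeries_mem`), the cleared Weierstrass equation of the image point
`P = ev₃(U)·u²` on `𝓔'` (`sq_imagePoint`) and hence `X'(T) = P` (`formalXMulSq_isogCurve_subst`, Silverman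
IV.1.1 uniqueness = the tree's `formalXMulSq_subst_eq_of_sq_eq`); over a ring in which `3` is invertible
`T = π·t·ev₁(X - x(P))·u` (`isogParam_eq`), `ω'(T)dT = π·ω` (`formalInvDiff_isogCurve_subst`), the Vélu +
Lemma 10 identity in the pole-free form of the tree's `formalXReg_rel_of_velu`
(`formalXMulSq_isogCurve_subst_eq_logForm`), and Blakestad–Grant's Prop. 13 hypothesis in `ρ`-form
`(π²ρ'(T) - 3ρ + T₀)u² = uD²u - (Du)²` (`formalXReg_rel`).

## Sources

* C. Blakestad, D. Grant, J. Number Theory 249 (2023) 348–376, Prop. 7 (a)–(c), Lemmas 10–12, Prop. 13.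
  [BlakestadGrant2023]
* J. Vélu, C. R. Acad. Sci. Paris 273 (1971) 238–241 (`ψ^*ω₁ = ω`). [Velu1971]
* J. H. Silverman, AEC 2nd ed. (2009), IV.1.1. [SilvermanAEC2009]
* Adapted from the tree files `PadicSigmaVeluKernelBridgeProofs.lean`, `VeluKernelReductionProofs.lean`
  (same statements with `a₂ = 0`), proof structure of
  `coeff_exp_sigmaExpArg_universalCurve_mem_of_veluKernelData` (steps S2–S6).

Provenance. Re-homed VERBATIM (declaration bodies unchanged; namespaces
`Summit.BirchSwinnertonDyer.Rank1Residual.X1.PadicSigmaThree[.Universal]` ↦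
`Literature.NumberTheory.EllipticCurves.PadicSigmaThree[.Universal]`, intra-tower imports re-pointed)
from `Summits/BirchSwinnertonDyer/Rank1Residual/X1/PadicSigmaThree*.lean` (cell `b2b-bsdres`, unit x1a,
2026-08-22), so that the discharge `Literature.NumberTheory.EllipticCurves.mazur_tate_sigma_exists_odd_holds`
of the Literature named fact `mazur_tate_sigma_exists_odd` (`PadicSigmaOddPrime.lean`) lives in
`Literature/` (which cannot import `Summits/`; ledger promote event 10878647). The `Summits/…/X1` copies are
thereby refactor debt (to be re-pointed at these modules by a librarian); nothing here is new mathematics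
relative to them.

Design notes. Two definitions with bodies (`Chart.unitSeries`, `Chart.isogParam`); theorems otherwise; no
named fact, no `sorry`; standard axioms. Two consecutive `noncomputable section … end` blocks.
-/

/-! ## Part `PadicSigmaThreeFormalIsogeny` (= `Summits/BirchSwinnertonDyer/Rank1Residual/X1/PadicSigmaThreeFormalIsogeny.lean`, declarations verbatim) -/

noncomputable section

open PowerSeries Literature.NumberTheory.EllipticCurves
open scoped Polynomial

namespace Literature.NumberTheory.EllipticCurves.PadicSigmaThree

open _root_.WeierstrassCurve

variable {𝒪 : Type*} [CommRing 𝒪] (W : WeierstrassCurve 𝒪) [W.IsCharNeTwoNF]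

variable {W}
variable {φO U₀ M₀ : 𝒪[X]} {A₂ A₀ B₀ : 𝒪} {p n : ℕ}

/-- **The cleared Weierstrass equation of `ψ` of the formal point, `a₂`-term kept.** From the model
`E'_p : y_p² = x_p³ + A₂x_p² + A₀x_p + B₀`, `x_p = U/φ²`, `y_p = yM/φ³`, i.e. the polynomial identity
`f·M² = U³ + A₂U²φ² + A₀Uφ⁴ + B₀φ⁶` (`f = X³ + a₂X² + a₄X + a₆`), the series `P = 𝒰·u²`
(`𝒰 = ev_p U`, `u = veluFormalUnit`) and `t_p = t·Φ·u` (`veluFormalIsog`) satisfy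
**`P² = P³ + A₂·t_p²·P² + A₀·t_p⁴·P + B₀·t_p⁶`**. (The tree's `sq_velu_image` is the case `A₂ = 0`,
`a₂ = 0`; same proof with one more term.) [Blakestad–Grant 2023, Prop. 7 (a),(c)]
[cite: BlakestadGrant2023, Prop. 7] -/
theorem sq_velu_image_of_isCharNeTwoNF (hp : 2 * n + 1 = p) (hφ : φO.natDegree ≤ n) (hU : U₀.natDegree ≤ p)
    (hM : M₀.natDegree ≤ 3 * n) (hM1 : M₀.coeff (3 * n) = 1)
    (hAB : W.rhsCubic * M₀ ^ 2 =
      U₀ ^ 3 + Polynomial.C A₂ * U₀ ^ 2 * φO ^ 2 + Polynomial.C A₀ * U₀ * φO ^ 4 + Polynomial.C B₀ * φO ^ 6) :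
    (W.clearedEval p U₀ * W.veluFormalUnit U₀ M₀ p n ^ 2) ^ 2 =
      (W.clearedEval p U₀ * W.veluFormalUnit U₀ M₀ p n ^ 2) ^ 3 +
        C A₂ * W.veluFormalIsog φO U₀ M₀ p n ^ 2 * (W.clearedEval p U₀ * W.veluFormalUnit U₀ M₀ p n ^ 2) ^ 2 +
        C A₀ * W.veluFormalIsog φO U₀ M₀ p n ^ 4 * (W.clearedEval p U₀ * W.veluFormalUnit U₀ M₀ p n ^ 2) +
        C B₀ * W.veluFormalIsog φO U₀ M₀ p n ^ 6 := by
  set 𝒰 := W.clearedEval p U₀ with h𝒰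
  set Φ := W.clearedEval n φO with hΦ
  set ℳ := W.clearedEval (3 * n) M₀ with hℳ
  set u := W.veluFormalUnit U₀ M₀ p n with hu
  have htp : W.veluFormalIsog φO U₀ M₀ p n = X * Φ * u := rfl
  have hunit : u * (W.formalXMulSq * ℳ) = 𝒰 := veluFormalUnit_mul hM hM1
  -- evaluate the polynomial identity at level `3p`
  have hdegf : W.rhsCubic.natDegree ≤ 3 := W.natDegree_rhsCubic_le
  have hM2 : (M₀ ^ 2).natDegree ≤ 3 * n + 3 * n := (Polynomial.natDegree_pow_le_of_le 2 hM).trans (by omega)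
  have hφ2 : (φO ^ 2).natDegree ≤ 2 * n := (Polynomial.natDegree_pow_le_of_le 2 hφ).trans (by omega)
  have hφ4 : (φO ^ 4).natDegree ≤ 4 * n := (Polynomial.natDegree_pow_le_of_le 4 hφ).trans (by omega)
  have hφ6 : (φO ^ 6).natDegree ≤ 6 * n := (Polynomial.natDegree_pow_le_of_le 6 hφ).trans (by omega)
  have hU2 : (U₀ ^ 2).natDegree ≤ p + p := (Polynomial.natDegree_pow_le_of_le 2 hU).trans (by omega)
  have hL : W.clearedEval (3 * p) (W.rhsCubic * M₀ ^ 2) = W.formalXMulSq ^ 2 * ℳ ^ 2 := by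
    rw [show 3 * p = 3 + (3 * n + 3 * n) by omega, W.clearedEval_mul hdegf hM2, clearedEval_rhsCubic_eq_sq,
      pow_two M₀, W.clearedEval_mul hM hM, ← hℳ, pow_two ℳ]
  have hR1 : W.clearedEval (3 * p) (U₀ ^ 3) = 𝒰 ^ 3 := by
    rw [show 3 * p = p + p + p by omega, pow_three', W.clearedEval_mul ((Polynomial.natDegree_mul_le).trans
      (add_le_add hU hU)) hU, W.clearedEval_mul hU hU, ← h𝒰]
    ring
  have hR0 : W.clearedEval (3 * p) (Polynomial.C A₂ * U₀ ^ 2 * φO ^ 2) = X ^ 2 * (C A₂ * 𝒰 ^ 2 * Φ ^ 2) := by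
    rw [show 3 * p = ((p + p) + 2 * n) + 1 by omega, W.clearedEval_add_right 1 (by
        rw [mul_assoc]; exact (Polynomial.natDegree_C_mul_le _ _).trans (Polynomial.natDegree_mul_le.trans (add_le_add hU2 hφ2))),
      mul_assoc, clearedEval_C_mul, W.clearedEval_mul hU2 hφ2, pow_two U₀, W.clearedEval_mul hU hU, ← h𝒰,
      show 2 * n = n + n by ring, pow_two φO, W.clearedEval_mul hφ hφ, ← hΦ]
    ring
  have hR2 : W.clearedEval (3 * p) (Polynomial.C A₀ * U₀ * φO ^ 4) = X ^ 4 * (C A₀ * 𝒰 * Φ ^ 4) := by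
    rw [show 3 * p = (p + 4 * n) + 2 by omega, W.clearedEval_add_right 2 (by
        rw [mul_assoc]; exact (Polynomial.natDegree_C_mul_le _ _).trans (Polynomial.natDegree_mul_le.trans (add_le_add hU hφ4))),
      mul_assoc, clearedEval_C_mul, W.clearedEval_mul hU hφ4, ← h𝒰,
      show 4 * n = n + n + n + n by ring, show φO ^ 4 = φO * φO * φO * φO by ring,
      W.clearedEval_mul ((Polynomial.natDegree_mul_le).trans (add_le_add ((Polynomial.natDegree_mul_le).trans
        (add_le_add hφ hφ)) hφ)) hφ,
      W.clearedEval_mul ((Polynomial.natDegree_mul_le).trans (add_le_add hφ hφ)) hφ, W.clearedEval_mul hφ hφ, ← hΦ]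
    ring
  have hR3 : W.clearedEval (3 * p) (Polynomial.C B₀ * φO ^ 6) = X ^ 6 * (C B₀ * Φ ^ 6) := by
    rw [show 3 * p = 6 * n + 3 by omega, W.clearedEval_add_right 3 ((Polynomial.natDegree_C_mul_le _ _).trans hφ6),
      clearedEval_C_mul, show 6 * n = n + n + n + n + n + n by ring,
      show φO ^ 6 = φO * φO * φO * φO * φO * φO by ring,
      W.clearedEval_mul ((Polynomial.natDegree_mul_le).trans (add_le_add ((Polynomial.natDegree_mul_le).trans
        (add_le_add ((Polynomial.natDegree_mul_le).trans (add_le_add ((Polynomial.natDegree_mul_le).trans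
        (add_le_add hφ hφ)) hφ)) hφ)) hφ)) hφ,
      W.clearedEval_mul ((Polynomial.natDegree_mul_le).trans (add_le_add ((Polynomial.natDegree_mul_le).trans
        (add_le_add ((Polynomial.natDegree_mul_le).trans (add_le_add hφ hφ)) hφ)) hφ)) hφ,
      W.clearedEval_mul ((Polynomial.natDegree_mul_le).trans (add_le_add ((Polynomial.natDegree_mul_le).trans
        (add_le_add hφ hφ)) hφ)) hφ,
      W.clearedEval_mul ((Polynomial.natDegree_mul_le).trans (add_le_add hφ hφ)) hφ, W.clearedEval_mul hφ hφ, ← hΦ]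
    ring
  have hev := congrArg (W.clearedEval (3 * p)) hAB
  rw [hL, clearedEval_add, clearedEval_add, clearedEval_add, hR1, hR0, hR2, hR3] at hev
  -- `X²ℳ²·u² = 𝒰²`; multiply by `u⁶`
  rw [htp]
  linear_combination u ^ 6 * hev - (u * (W.formalXMulSq * ℳ) + 𝒰) * u ^ 4 * hunit

/-- **`ψ^*ω' = π·ω`, cleared, for the RESCALED parameter `T = c·t_p`** (any `a₁ = a₃ = 0` model): with
`P = 𝒰u²`, `t_p = tΦu`, a scalar `c` (downstream `c = ℓ₀⁻¹`, `π = p·c = p/ℓ₀`) and the normalisation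
`U'φ - 2Uφ' = p·M` (`(U/φ²)' = pM/φ³`): **`η·(T·P^• - 2P·T^•) = -2(pc)·P`** (`η = dz/ω`, `Dx = 2y`).
For `c = 1` and a short model this is the tree's `formalEta_mul_velu_image`, whose proof (the pole-cleared
derivations `𝒟_{2p}𝒰 = -2ev_p(xU')`, `𝒟_{2n}Φ = -2ev_n(xφ')`) uses only `a₁ = a₃ = 0` and is repeated here.
[Blakestad–Grant 2023, Prop. 7 (c), Lemma 12; Vélu 1971] [cite: BlakestadGrant2023, Prop. 7] -/
theorem formalEta_mul_velu_image_scaled (c : 𝒪) (hp : 2 * n + 1 = p) (hφ : φO.natDegree ≤ n)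
    (hU : U₀.natDegree ≤ p) (hM : M₀.natDegree ≤ 3 * n) (hM1 : M₀.coeff (3 * n) = 1)
    (hMder : Polynomial.derivative U₀ * φO - 2 * U₀ * Polynomial.derivative φO = Polynomial.C (p : 𝒪) * M₀) :
    W.formalEta * ((C c * W.veluFormalIsog φO U₀ M₀ p n) * d⁄dX 𝒪 (W.clearedEval p U₀ * W.veluFormalUnit U₀ M₀ p n ^ 2) -
      2 * (W.clearedEval p U₀ * W.veluFormalUnit U₀ M₀ p n ^ 2) * d⁄dX 𝒪 (C c * W.veluFormalIsog φO U₀ M₀ p n)) =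
      -2 * C ((p : 𝒪) * c) * (W.clearedEval p U₀ * W.veluFormalUnit U₀ M₀ p n ^ 2) := by
  -- `(c·t_p)^• = c·t_p^•`: reduce to `c = 1`
  have hder : d⁄dX 𝒪 (C c * W.veluFormalIsog φO U₀ M₀ p n) = C c * d⁄dX 𝒪 (W.veluFormalIsog φO U₀ M₀ p n) := by
    rw [Derivation.leibniz, derivative_C, smul_zero, add_zero, smul_eq_mul]
  rw [hder]
  suffices hmain : W.formalEta * (W.veluFormalIsog φO U₀ M₀ p n * d⁄dX 𝒪 (W.clearedEval p U₀ * W.veluFormalUnit U₀ M₀ p n ^ 2) -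
      2 * (W.clearedEval p U₀ * W.veluFormalUnit U₀ M₀ p n ^ 2) * d⁄dX 𝒪 (W.veluFormalIsog φO U₀ M₀ p n)) =
      -2 * C (p : 𝒪) * (W.clearedEval p U₀ * W.veluFormalUnit U₀ M₀ p n ^ 2) by
    rw [show C ((p : 𝒪) * c) = C (p : 𝒪) * C c from map_mul C _ _]
    linear_combination C c * hmain
  set 𝒰 := W.clearedEval p U₀ with h𝒰
  set Φ := W.clearedEval n φO with hΦ
  set ℳ := W.clearedEval (3 * n) M₀ with hℳ
  set u := W.veluFormalUnit U₀ M₀ p n with hu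
  have htp : W.veluFormalIsog φO U₀ M₀ p n = X * Φ * u := rfl
  have hunit : u * (W.formalXMulSq * ℳ) = 𝒰 := veluFormalUnit_mul hM hM1
  have hDU := W.clearedDeriv_clearedEval_eq hU
  have hDΦ := W.clearedDeriv_clearedEval_eq hφ
  rw [← h𝒰] at hDU
  rw [← hΦ] at hDΦ
  have hXd : ∀ {Q : 𝒪[X]} {d : ℕ}, Q.natDegree ≤ d → (Polynomial.X * Polynomial.derivative Q).natDegree ≤ d := by
    intro Q d hQ
    by_cases h0 : Q.natDegree = 0
    · rw [Polynomial.derivative_of_natDegree_zero h0, mul_zero, Polynomial.natDegree_zero]; exact Nat.zero_le _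
    · refine (Polynomial.natDegree_mul_le).trans ?_
      have := Polynomial.natDegree_derivative_le Q
      have h1 : (Polynomial.X : 𝒪[X]).natDegree ≤ 1 := Polynomial.natDegree_X_le
      omega
  have hXU : (Polynomial.X * Polynomial.derivative U₀).natDegree ≤ p := hXd hU
  have hXφ : (Polynomial.X * Polynomial.derivative φO).natDegree ≤ n := hXd hφ
  have hkey : Φ * W.clearedEval p (Polynomial.X * Polynomial.derivative U₀) -
      2 * 𝒰 * W.clearedEval n (Polynomial.X * Polynomial.derivative φO) =
      C (p : 𝒪) * (W.formalXMulSq * ℳ) := by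
    have h1 : W.clearedEval (n + p) (φO * (Polynomial.X * Polynomial.derivative U₀)) =
        Φ * W.clearedEval p (Polynomial.X * Polynomial.derivative U₀) := by rw [W.clearedEval_mul hφ hXU, ← hΦ]
    have h2 : W.clearedEval (n + p) (U₀ * (Polynomial.X * Polynomial.derivative φO)) =
        𝒰 * W.clearedEval n (Polynomial.X * Polynomial.derivative φO) := by
      rw [add_comm, W.clearedEval_mul hU hXφ, ← h𝒰]
    have h3 : W.clearedEval (n + p) (Polynomial.X * (Polynomial.C (p : 𝒪) * M₀)) = C (p : 𝒪) * (W.formalXMulSq * ℳ) := by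
      rw [show n + p = 3 * n + 1 by omega, W.clearedEval_X_mul ((Polynomial.natDegree_C_mul_le _ _).trans hM),
        clearedEval_C_mul, ← hℳ]
      ring
    have hpol : φO * (Polynomial.X * Polynomial.derivative U₀) - 2 * (U₀ * (Polynomial.X * Polynomial.derivative φO)) =
        Polynomial.X * (Polynomial.C (p : 𝒪) * M₀) := by
      rw [← hMder]; ring
    have h4 := congrArg (W.clearedEval (n + p)) hpol
    rw [clearedEval_sub, show (2 : 𝒪[X]) * (U₀ * (Polynomial.X * Polynomial.derivative φO)) =
        Polynomial.C (2 : 𝒪) * (U₀ * (Polynomial.X * Polynomial.derivative φO)) by rw [map_ofNat],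
      clearedEval_C_mul, h1, h2, h3, map_ofNat] at h4
    linear_combination h4
  have hdefU : W.clearedDeriv (2 * p) 𝒰 = W.formalEta * (X * d⁄dX 𝒪 𝒰 - ((2 * p : ℕ) : 𝒪⟦X⟧) * 𝒰) := rfl
  have hdefΦ : W.clearedDeriv (2 * n) Φ = W.formalEta * (X * d⁄dX 𝒪 Φ - ((2 * n : ℕ) : 𝒪⟦X⟧) * Φ) := rfl
  have hpn : ((2 * p : ℕ) : 𝒪⟦X⟧) = 2 * ((2 * n : ℕ) : 𝒪⟦X⟧) + 2 := by
    rw [← hp]; push_cast; ring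
  rw [hpn] at hdefU
  rw [htp, show W.clearedEval p U₀ * u ^ 2 = 𝒰 * (u * u) by rw [h𝒰, pow_two]]
  simp only [Derivation.leibniz, derivative_X, smul_eq_mul]
  linear_combination (-(u ^ 3 * Φ)) * hdefU + (2 * u ^ 3 * 𝒰) * hdefΦ + (u ^ 3 * Φ) * hDU -
    (2 * u ^ 3 * 𝒰) * hDΦ - (2 * u ^ 3) * hkey - (2 * C (p : 𝒪) * u ^ 2) * hunit

/-- **`u ≡ 1 (mod p)`** for any `a₁ = a₃ = 0` model: modulo `p`, `𝒰 ≡ X^p` (`U ≡ x^p`) and `ℳ ≡ X^{2n}`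
(`M ≡ fⁿ`, `ev_{3n}(fⁿ) = X^{2n}`), so `ū·X̄^{2n+1} = X̄^p` with `X̄` a unit. (The tree's
`map_veluFormalUnit_sub_one` with `f = rhsCubic` in place of `X³ + a₄X + a₆`.) [Blakestad–Grant 2023,
Lemma 12] [cite: BlakestadGrant2023, Lemma 12] -/
theorem map_veluFormalUnit_sub_one_of_isCharNeTwoNF (hp : 2 * n + 1 = p)
    (hU : U₀.natDegree ≤ p) (hUp : ∀ i, (p : 𝒪) ∣ (U₀ - Polynomial.X ^ p).coeff i)
    (hM : M₀.natDegree ≤ 3 * n) (hM1 : M₀.coeff (3 * n) = 1)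
    (hMp : ∀ i, (p : 𝒪) ∣ (M₀ - W.rhsCubic ^ n).coeff i) :
    PowerSeries.map (Ideal.Quotient.mk (Ideal.span {(p : 𝒪)})) (W.veluFormalUnit U₀ M₀ p n - 1) = 0 := by
  set mk := Ideal.Quotient.mk (Ideal.span {(p : 𝒪)}) with hmk
  set Xs := W.formalXMulSq with hXs
  have hXp : (Polynomial.X ^ p : 𝒪[X]).natDegree ≤ p := Polynomial.natDegree_X_pow_le p
  have hU' : PowerSeries.map mk (W.clearedEval p U₀) = PowerSeries.map mk Xs ^ p := by
    have h := W.map_clearedEval_eq_zero (g := U₀ - Polynomial.X ^ p)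
      ((Polynomial.natDegree_sub_le _ _).trans (max_le hU hXp)) hUp
    rwa [clearedEval_sub, map_sub, sub_eq_zero, W.clearedEval_X_pow le_rfl, Nat.sub_self, mul_zero, pow_zero,
      mul_one, map_pow] at h
  have hfn : (W.rhsCubic ^ n).natDegree ≤ 3 * n :=
    Polynomial.natDegree_pow_le.trans ((Nat.mul_le_mul_left n W.natDegree_rhsCubic_le).trans (le_of_eq (mul_comm n 3)))
  have hM' : PowerSeries.map mk (W.clearedEval (3 * n) M₀) = PowerSeries.map mk Xs ^ (2 * n) := by
    have h := W.map_clearedEval_eq_zero (g := M₀ - W.rhsCubic ^ n) ((Polynomial.natDegree_sub_le _ _).trans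
      (max_le hM hfn)) hMp
    rwa [clearedEval_sub, map_sub, sub_eq_zero, W.clearedEval_pow_rhsCubic, map_pow] at h
  have hid := congrArg (PowerSeries.map mk) (veluFormalUnit_mul (W := W) (U₀ := U₀) (p := p) hM hM1)
  rw [map_mul, map_mul, hU', hM', ← hXs, ← pow_succ', hp] at hid
  have hXsu : PowerSeries.map mk Xs ^ p * (PowerSeries.map mk Xs ^ p).invOfUnit 1 = 1 :=
    PowerSeries.mul_invOfUnit _ _ (by rw [map_pow, ← PowerSeries.coeff_zero_eq_constantCoeff, PowerSeries.coeff_map,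
      PowerSeries.coeff_zero_eq_constantCoeff, hXs, W.constantCoeff_formalXMulSq, map_one, one_pow, Units.val_one])
  rw [map_sub, map_one]
  linear_combination (PowerSeries.map mk Xs ^ p).invOfUnit 1 * hid -
    (PowerSeries.map mk (W.veluFormalUnit U₀ M₀ p n) - 1) * hXsu

/-- **`t_p ≡ ℓ₀·t^p (mod p)`** for any `a₁ = a₃ = 0` model (`ℓ₀ = φ(0)`): modulo `p`, `Φ ≡ ℓ₀t^{2n}`
and `u ≡ 1`. (The tree's `map_veluFormalIsog_sub` with `f = rhsCubic`.) [Blakestad–Grant 2023, Prop. 7(c)]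
[cite: BlakestadGrant2023, Prop. 7] -/
theorem map_veluFormalIsog_sub_of_isCharNeTwoNF (hp : 2 * n + 1 = p)
    (hφ : φO.natDegree ≤ n) (hφp : ∀ i, 1 ≤ i → (p : 𝒪) ∣ φO.coeff i)
    (hU : U₀.natDegree ≤ p) (hUp : ∀ i, (p : 𝒪) ∣ (U₀ - Polynomial.X ^ p).coeff i)
    (hM : M₀.natDegree ≤ 3 * n) (hM1 : M₀.coeff (3 * n) = 1)
    (hMp : ∀ i, (p : 𝒪) ∣ (M₀ - W.rhsCubic ^ n).coeff i) :
    PowerSeries.map (Ideal.Quotient.mk (Ideal.span {(p : 𝒪)}))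
      (W.veluFormalIsog φO U₀ M₀ p n - PowerSeries.C (φO.coeff 0) * PowerSeries.X ^ p) = 0 := by
  set mk := Ideal.Quotient.mk (Ideal.span {(p : 𝒪)}) with hmk
  have hu := map_veluFormalUnit_sub_one_of_isCharNeTwoNF (W := W) hp hU hUp hM hM1 hMp
  rw [map_sub, map_one, sub_eq_zero] at hu
  have hΦ : PowerSeries.map mk (W.clearedEval n φO) = PowerSeries.C (mk (φO.coeff 0)) * PowerSeries.X ^ (2 * n) := by
    have hdeg : (φO - Polynomial.C (φO.coeff 0)).natDegree ≤ n :=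
      (Polynomial.natDegree_sub_le _ _).trans (max_le hφ (by rw [Polynomial.natDegree_C]; exact Nat.zero_le _))
    have hdvd : ∀ i, (p : 𝒪) ∣ (φO - Polynomial.C (φO.coeff 0)).coeff i := by
      intro i
      rw [Polynomial.coeff_sub, Polynomial.coeff_C]
      split_ifs with hi
      · rw [hi, sub_self]; exact dvd_zero _
      · rw [sub_zero]; exact hφp i (Nat.one_le_iff_ne_zero.mpr hi)
    have h := W.map_clearedEval_eq_zero hdeg hdvd
    rwa [clearedEval_sub, map_sub, sub_eq_zero, show Polynomial.C (φO.coeff 0) = Polynomial.C (φO.coeff 0) *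
      Polynomial.X ^ 0 by rw [pow_zero, mul_one], W.clearedEval_C_mul_X_pow (Nat.zero_le n), pow_zero, one_mul,
      Nat.sub_zero, map_mul, map_pow, PowerSeries.map_C, PowerSeries.map_X] at h
  rw [map_sub, veluFormalIsog, map_mul, map_mul, hu, hΦ, PowerSeries.map_X, mul_one, map_mul, map_pow,
    PowerSeries.map_C, PowerSeries.map_X,
    show (PowerSeries.X ^ p : PowerSeries (𝒪 ⧸ Ideal.span {(p : 𝒪)})) = PowerSeries.X ^ (2 * n) * PowerSeries.X by
      rw [← pow_succ, hp]]
  ring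

end Literature.NumberTheory.EllipticCurves.PadicSigmaThree

end

/-! ## Part `PadicSigmaThreeFormalIsogenyChart` (= `Summits/BirchSwinnertonDyer/Rank1Residual/X1/PadicSigmaThreeFormalIsogenyChart.lean`, declarations verbatim) -/

noncomputable section

open PowerSeries Literature.NumberTheory.EllipticCurves
open scoped Polynomial

namespace Literature.NumberTheory.EllipticCurves.PadicSigmaThree

namespace Chart

variable {R : Type*} [CommRing R] (d : Chart R)

/-! ## The two series -/

/-- **Blakestad–Grant's unit series `u = 𝒰/(X·ℳ)`** of the canonical `3`-isogeny (`𝒰 = ev₃(U)`,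
`ℳ = ev₃(M)`, `X = t²x(t)`): the tree's `veluFormalUnit U M 3 1`. [cite: BlakestadGrant2023, Lemma 12] -/
def unitSeries : R⟦X⟧ := d.curve.veluFormalUnit d.xNum d.yNum 3 1

/-- **The parameter of the isogeny `T = t'∘ψ = ℓ₀⁻¹·t·Φ·u`**, `ℓ₀ = φ(0) = -Y` (`Φ = ev₁(φ)`): the formal
group homomorphism `𝓔̂ → 𝓔̂'` induced by `ψ` in the coordinates of `𝓔' = isogCurve` (`x' = ℓ₀²·U/φ²`).
[cite: BlakestadGrant2023, Lemma 12] -/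
def isogParam : R⟦X⟧ := C (-d.yi) * d.curve.veluFormalIsog d.kernelPoly d.xNum d.yNum 3 1

/-- `u(0) = 1`. [cite: BlakestadGrant2023, Lemma 12] -/
theorem constantCoeff_unitSeries : constantCoeff d.unitSeries = 1 := by
  rw [unitSeries, WeierstrassCurve.veluFormalUnit, map_mul, d.curve.constantCoeff_clearedEval d.natDegree_xNum_le,
    coeff_xNum_three, one_mul, constantCoeff_invOfUnit, inv_one, Units.val_one]

/-- **`u ≡ 1 (mod 3)`**: every positive-degree coefficient of `u` lies in `3R` (`U ≡ X³`, `M ≡ f`).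
[cite: BlakestadGrant2023, Lemma 12] -/
theorem coeff_succ_unitSeries_mem (i : ℕ) : coeff (i + 1) d.unitSeries ∈ Ideal.span {(3 : R)} := by
  have h := map_veluFormalUnit_sub_one_of_isCharNeTwoNF (W := d.curve) (p := 3) (n := 1) (by norm_num)
    d.natDegree_xNum_le (fun i => by exact_mod_cast d.dvd_coeff_xNum_sub i) d.natDegree_yNum_le d.coeff_yNum_three
    (fun i => by exact_mod_cast d.dvd_coeff_yNum_sub i)
  have h1 : Ideal.Quotient.mk (Ideal.span {((3 : ℕ) : R)}) (coeff (i + 1) (d.unitSeries - 1)) = 0 := by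
    rw [← coeff_map, unitSeries, h]; rfl
  rw [map_sub, coeff_one, if_neg (Nat.succ_ne_zero i), sub_zero, Nat.cast_ofNat] at h1
  exact Ideal.Quotient.eq_zero_iff_mem.mp h1

/-- `[t¹]u = 0` (parity: `a₁ = 0`). [cite: BlakestadGrant2023, Lemma 12] -/
theorem coeff_one_unitSeries : coeff 1 d.unitSeries = 0 := by
  set Q := d.curve.formalXMulSq * d.curve.clearedEval (3 * 1) d.yNum with hQ
  have hQ0 : constantCoeff Q = 1 :=
    WeierstrassCurve.constantCoeff_formalXMulSq_mul_clearedEval d.natDegree_yNum_le d.coeff_yNum_three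
  have hev1 : ∀ {g : R[X]} {e : ℕ}, g.natDegree ≤ e → coeff 1 (d.curve.clearedEval e g) = 0 := by
    intro g e hg
    rw [d.curve.clearedEval_eq_sum hg, map_sum]
    refine Finset.sum_eq_zero fun k hk => ?_
    have hk' : k ≤ e := Nat.lt_succ_iff.mp (Finset.mem_range.mp hk)
    rw [coeff_C_mul]
    rcases Nat.eq_or_lt_of_le hk' with rfl | hlt
    · rw [Nat.sub_self, mul_zero, pow_zero, mul_one,
        coeff_one_pow_eq_zero (by rw [d.curve.coeff_one_formalXMulSq, curve_a₁, neg_zero]), mul_zero]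
    · rw [mul_comm (d.curve.formalXMulSq ^ k), coeff_X_pow_mul', if_neg (by omega), mul_zero]
  have hQ1 : coeff 1 Q = 0 := by
    rw [hQ, coeff_mul, Finset.Nat.antidiagonal_succ, Finset.sum_cons, Finset.Nat.antidiagonal_zero, Finset.map_singleton,
      Finset.sum_singleton]
    simp only [Function.Embedding.coe_prodMap, Function.Embedding.coeFn_mk, Prod.map_apply, Nat.succ_eq_add_one,
      zero_add, Function.Embedding.refl_apply, coeff_zero_eq_constantCoeff_apply]
    rw [hev1 d.natDegree_yNum_le, d.curve.coeff_one_formalXMulSq, curve_a₁, neg_zero, zero_mul, add_zero, mul_zero]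
  set v := Q.invOfUnit 1 with hv
  have hQv : Q * v = 1 := mul_invOfUnit Q 1 (by rw [hQ0, Units.val_one])
  have hv1 : coeff 1 v = 0 := by
    have h := congrArg (coeff 1) hQv
    rw [coeff_mul, Finset.Nat.antidiagonal_succ, Finset.sum_cons, Finset.Nat.antidiagonal_zero, Finset.map_singleton,
      Finset.sum_singleton, coeff_one, if_neg one_ne_zero] at h
    simp only [Function.Embedding.coe_prodMap, Function.Embedding.coeFn_mk, Prod.map_apply, Nat.succ_eq_add_one,
      zero_add, Function.Embedding.refl_apply, coeff_zero_eq_constantCoeff_apply, hQ0, one_mul, hQ1, zero_mul,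
      add_zero] at h
    exact h
  rw [unitSeries, WeierstrassCurve.veluFormalUnit, ← hQ, ← hv, coeff_mul, Finset.Nat.antidiagonal_succ, Finset.sum_cons,
    Finset.Nat.antidiagonal_zero, Finset.map_singleton, Finset.sum_singleton]
  simp only [Function.Embedding.coe_prodMap, Function.Embedding.coeFn_mk, Prod.map_apply, Nat.succ_eq_add_one,
    zero_add, Function.Embedding.refl_apply, coeff_zero_eq_constantCoeff_apply, hv1, mul_zero,
    hev1 d.natDegree_xNum_le, zero_mul, add_zero]

/-- `T(0) = 0`. [cite: BlakestadGrant2023, Lemma 12] -/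
theorem constantCoeff_isogParam : constantCoeff d.isogParam = 0 := by
  rw [isogParam, map_mul, WeierstrassCurve.constantCoeff_veluFormalIsog, mul_zero]

/-- `[t¹]T = π` (`ψ^*ω' = πω`). [cite: BlakestadGrant2023, Prop. 7] -/
theorem coeff_one_isogParam : coeff 1 d.isogParam = d.piConst := by
  rw [isogParam, coeff_C_mul, WeierstrassCurve.coeff_one_veluFormalIsog d.natDegree_kernelPoly_le d.natDegree_xNum_le,
    coeff_kernelPoly_one, coeff_xNum_three, piConst]
  ring

/-- **`T ≡ t³ (mod 3)`**: `[tⁱ]T - δ_{i,3} ∈ 3R` for every `i` (`t₃ ≡ ℓ₀t³`, `ℓ₀ = -Y`, `T = -Y⁻¹t₃`).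
[cite: BlakestadGrant2023, Prop. 7] -/
theorem coeff_isogParam_sub_mem (i : ℕ) :
    coeff i d.isogParam - (if i = 3 then 1 else 0) ∈ Ideal.span {(3 : R)} := by
  have h := map_veluFormalIsog_sub_of_isCharNeTwoNF (W := d.curve) (p := 3) (n := 1) (by norm_num)
    d.natDegree_kernelPoly_le (fun i hi => by exact_mod_cast d.dvd_coeff_kernelPoly i hi) d.natDegree_xNum_le
    (fun i => by exact_mod_cast d.dvd_coeff_xNum_sub i) d.natDegree_yNum_le d.coeff_yNum_three
    (fun i => by exact_mod_cast d.dvd_coeff_yNum_sub i)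
  have h1 : Ideal.Quotient.mk (Ideal.span {((3 : ℕ) : R)})
      (coeff i (d.curve.veluFormalIsog d.kernelPoly d.xNum d.yNum 3 1 - C (d.kernelPoly.coeff 0) * X ^ 3)) = 0 := by
    rw [← coeff_map, h]; rfl
  rw [Nat.cast_ofNat] at h1
  have hi := Ideal.Quotient.eq_zero_iff_mem.mp h1
  have e : coeff i d.isogParam - (if i = 3 then 1 else 0) =
      -d.yi * coeff i (d.curve.veluFormalIsog d.kernelPoly d.xNum d.yNum 3 1 - C (d.kernelPoly.coeff 0) * X ^ 3) := by
    rw [isogParam, coeff_C_mul, map_sub, coeff_C_mul, coeff_X_pow, coeff_kernelPoly_zero]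
    split_ifs
    · linear_combination d.Y_mul_yi
    · ring
  rw [e]; exact Ideal.mul_mem_left _ _ hi

/-! ## Base change -/

section Map

variable {S : Type*} [CommRing S] (φ : R →+* S)

/-- `invOfUnit 1` commutes with ring maps for series with constant term `1`. [folklore] -/
private theorem map_invOfUnit_one {F : R⟦X⟧} (hF : constantCoeff F = 1) :
    PowerSeries.map φ (F.invOfUnit 1) = (PowerSeries.map φ F).invOfUnit 1 := by
  have hF' : constantCoeff (PowerSeries.map φ F) = 1 := by
    rw [← coeff_zero_eq_constantCoeff_apply, coeff_map, coeff_zero_eq_constantCoeff_apply, hF, map_one]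
  have h1 : PowerSeries.map φ F * PowerSeries.map φ (F.invOfUnit 1) = 1 := by
    rw [← map_mul, mul_invOfUnit F 1 (by rw [hF, Units.val_one]), map_one]
  have h2 : PowerSeries.map φ F * (PowerSeries.map φ F).invOfUnit 1 = 1 :=
    mul_invOfUnit _ 1 (by rw [hF', Units.val_one])
  have hu : IsUnit (PowerSeries.map φ F) := IsUnit.of_mul_eq_one _ h2
  exact hu.mul_left_cancel (h1.trans h2.symm)

/-- `u` commutes with base change. [cite: BlakestadGrant2023, Lemma 12] -/
theorem unitSeries_map : (d.map φ).unitSeries = PowerSeries.map φ d.unitSeries := by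
  rw [unitSeries, unitSeries, WeierstrassCurve.veluFormalUnit, WeierstrassCurve.veluFormalUnit, curve_map, xNum_map,
    yNum_map, ← WeierstrassCurve.map_clearedEval _ φ d.natDegree_xNum_le, ← WeierstrassCurve.map_clearedEval _ φ d.natDegree_yNum_le,
    ← WeierstrassCurve.map_formalXMulSq, map_mul, ← map_mul,
    map_invOfUnit_one φ (WeierstrassCurve.constantCoeff_formalXMulSq_mul_clearedEval d.natDegree_yNum_le d.coeff_yNum_three)]

/-- `T` commutes with base change. [cite: BlakestadGrant2023, Lemma 12] -/
theorem isogParam_map : (d.map φ).isogParam = PowerSeries.map φ d.isogParam := by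
  rw [isogParam, isogParam, WeierstrassCurve.veluFormalIsog, WeierstrassCurve.veluFormalIsog, ← unitSeries, ← unitSeries,
    unitSeries_map, curve_map, kernelPoly_map, ← WeierstrassCurve.map_clearedEval _ φ d.natDegree_kernelPoly_le, map_yi,
    map_mul, map_mul, map_mul, map_C, map_X]
  simp only [map_neg, neg_mul, mul_assoc]

end Map

/-! ## The image point `P = ev₃(U)·u²` and `X'(T) = P` -/

/-- **The cleared Weierstrass equation of the image of the formal point on `𝓔'`**:
`P² = P³ + a₂'T²P² + a₄'T⁴P + a₆'T⁶` for `P = ev₃(U)·u²`, `T = isogParam` — from `weierstrass` by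
`sq_velu_image_of_isCharNeTwoNF` (`(a₂'/Y²)·t₃² = a₂'·T²` etc., `T = -Y⁻¹t₃`).
[cite: BlakestadGrant2023, Prop. 7] -/
theorem sq_imagePoint :
    (d.curve.clearedEval 3 d.xNum * d.unitSeries ^ 2) ^ 2 =
      (d.curve.clearedEval 3 d.xNum * d.unitSeries ^ 2) ^ 3 +
        C d.isogCurve.a₁ * d.isogParam * (d.curve.clearedEval 3 d.xNum * d.unitSeries ^ 2) ^ 2 +
        C d.isogCurve.a₂ * d.isogParam ^ 2 * (d.curve.clearedEval 3 d.xNum * d.unitSeries ^ 2) ^ 2 +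
        C d.isogCurve.a₃ * d.isogParam ^ 3 * (d.curve.clearedEval 3 d.xNum * d.unitSeries ^ 2) +
        C d.isogCurve.a₄ * d.isogParam ^ 4 * (d.curve.clearedEval 3 d.xNum * d.unitSeries ^ 2) +
        C d.isogCurve.a₆ * d.isogParam ^ 6 := by
  have h := sq_velu_image_of_isCharNeTwoNF (W := d.curve) (p := 3) (n := 1) (by norm_num) d.natDegree_kernelPoly_le
    d.natDegree_xNum_le d.natDegree_yNum_le d.coeff_yNum_three d.weierstrass
  rw [isogCurve_a₁, isogCurve_a₂, isogCurve_a₃, isogCurve_a₄, isogCurve_a₆, isogParam, map_zero, zero_mul, zero_mul,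
    add_zero, zero_mul, zero_mul, add_zero]
  rw [← unitSeries] at h
  simp only [map_mul, map_pow, map_neg] at h ⊢
  linear_combination h

/-- **`X'(T) = ev₃(U)·u²`**: the `x`-coordinate series of `𝓔'` read through the isogeny parameter is the
image point (uniqueness of the formal chart, Silverman IV.1.1 / tree `formalXMulSq_subst_eq_of_sq_eq`).
[cite: SilvermanAEC2009, IV.1.1] -/
theorem formalXMulSq_isogCurve_subst :
    d.isogCurve.formalXMulSq.subst d.isogParam = d.curve.clearedEval 3 d.xNum * d.unitSeries ^ 2 :=
  d.isogCurve.formalXMulSq_subst_eq_of_sq_eq d.constantCoeff_isogParam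
    (by rw [map_mul, map_pow, d.constantCoeff_unitSeries, one_pow, mul_one,
      d.curve.constantCoeff_clearedEval d.natDegree_xNum_le, coeff_xNum_three]) d.sq_imagePoint

/-! ## Over a ring in which `3` is invertible: `ω'(T)dT = πω` and Prop. 13's hypothesis -/

section Third

variable {th : R} (h3 : (3 : R) * th = 1)
include h3

/-- `T = π·t·ev₁(X - x(P))·u` (`Φ = ev₁(φ) = 3·ev₁(X - x(P))`, `-Y⁻¹·3 = π`). [cite: BlakestadGrant2023, Lemma 12] -/
theorem isogParam_eq :
    d.isogParam = C d.piConst * X * d.curve.clearedEval 1 (Polynomial.X - Polynomial.C (d.Y * th)) * d.unitSeries := by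
  rw [isogParam, WeierstrassCurve.veluFormalIsog, ← unitSeries, d.kernelPoly_eq_mul h3, WeierstrassCurve.clearedEval_C_mul,
    piConst, show C (-3 * d.yi) = C (-d.yi) * (C 3 : R⟦X⟧) by rw [← map_mul]; ring_nf]
  ring

/-- **`ω'(T)dT = π·ω`** (`ψ^*ω' = πω`): `W'(T)·T^• = π·W` for the invariant differentials `ω = W(t)dt` of `𝓔`
and `ω' = W'(t')dt'` of `𝓔'`. From `formalEta_mul_velu_image_scaled` (`η(TP^• - 2PT^•) = -2πP`) and the chart
lemma `formalEta_subst_mul_eq` (`η'(T)(TP^• - 2PT^•) = -2PT^•`), dividing by the unit `TP^• - 2PT^•`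
(constant term `-2π`; `2`, `π` units). [cite: BlakestadGrant2023, Prop. 13] -/
theorem formalInvDiff_isogCurve_subst :
    d.isogCurve.formalInvDiff.subst d.isogParam * d⁄dX R d.isogParam = C d.piConst * d.curve.formalInvDiff := by
  set T := d.isogParam with hT
  set P := d.curve.clearedEval 3 d.xNum * d.unitSeries ^ 2 with hP
  have hT0 := d.constantCoeff_isogParam
  have hP0 : constantCoeff P = 1 := by
    rw [hP, map_mul, map_pow, d.constantCoeff_unitSeries, one_pow, mul_one,
      d.curve.constantCoeff_clearedEval d.natDegree_xNum_le, coeff_xNum_three]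
  have hηlem := d.isogCurve.formalEta_subst_mul_eq hT0 hP0 d.sq_imagePoint
  rw [isogCurve_a₁, isogCurve_a₃] at hηlem
  simp only [map_zero, zero_mul, zero_sub, add_zero] at hηlem
  have hV2 : d.curve.formalEta * (T * d⁄dX R P - 2 * P * d⁄dX R T) = -2 * C d.piConst * P := by
    have h := formalEta_mul_velu_image_scaled (W := d.curve) (p := 3) (n := 1) (-d.yi) (by norm_num)
      d.natDegree_kernelPoly_le d.natDegree_xNum_le d.natDegree_yNum_le d.coeff_yNum_three d.omega
    rw [← unitSeries, ← isogParam, ← hP, ← hT] at h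
    rw [h, piConst, Nat.cast_ofNat, show ((3 : R) * -d.yi) = -3 * d.yi by ring]
  have hsT : HasSubst T := HasSubst.of_constantCoeff_zero' hT0
  set Z := T * d⁄dX R P - 2 * P * d⁄dX R T with hZ
  have hZ0 : constantCoeff Z = -(2 * d.piConst) := by
    rw [hZ, map_sub, map_mul, hT0, zero_mul, zero_sub, map_mul, map_mul, hP0, mul_one,
      ← coeff_zero_eq_constantCoeff_apply (d⁄dX R _), coeff_derivative, zero_add, Nat.cast_zero, zero_add,
      mul_one, coeff_one_isogParam, map_ofNat]
  have hZu : IsUnit Z := by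
    rw [isUnit_iff_constantCoeff, hZ0, IsUnit.neg_iff]
    exact d.isUnit_two.mul (d.isUnit_piConst h3)
  have hηform : C d.piConst * d.isogCurve.formalEta.subst T = d.curve.formalEta * d⁄dX R T := by
    have h1 : Z * (C d.piConst * d.isogCurve.formalEta.subst T - d.curve.formalEta * d⁄dX R T) = 0 := by
      linear_combination C d.piConst * hηlem - d⁄dX R T * hV2
    exact sub_eq_zero.mp (hZu.mul_right_eq_zero.mp h1)
  have hηW' : d.isogCurve.formalEta.subst T * d.isogCurve.formalInvDiff.subst T = 1 := by
    rw [← subst_mul hsT, d.isogCurve.formalEta_mul_formalInvDiff, one_subst hsT]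
  have hηW := d.curve.formalEta_mul_formalInvDiff
  linear_combination (-(d.isogCurve.formalInvDiff.subst T * d.curve.formalInvDiff)) * hηform +
    (C d.piConst * d.curve.formalInvDiff) * hηW' - (d.isogCurve.formalInvDiff.subst T * d⁄dX R T) * hηW

/-- **`X'(T)` in the pole-free Vélu + Lemma 10 form** (hypothesis `hV` of the tree's `formalXReg_rel_of_velu`):
with `N = ev₁(X - x(P))`, `X'(T) = (3XN² + 2(zηη' - η²)N² - z²(N·D²N - (DN)²) - T₀z²N²)·u²` — from
`X'(T) = ev₃(U)u²`, the Kohel form of `U` and the tree's `clearedEval_logForm`. [cite: BlakestadGrant2023, Prop. 13] -/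
theorem formalXMulSq_isogCurve_subst_eq_logForm :
    d.isogCurve.formalXMulSq.subst d.isogParam =
      ((3 : R⟦X⟧) * d.curve.formalXMulSq * d.curve.clearedEval 1 (Polynomial.X - Polynomial.C (d.Y * th)) ^ 2 +
        ((3 : R⟦X⟧) - 1) * (X * d.curve.formalEta * d⁄dX R d.curve.formalEta - d.curve.formalEta ^ 2) *
          d.curve.clearedEval 1 (Polynomial.X - Polynomial.C (d.Y * th)) ^ 2 -
        X ^ 2 * logDeriv₂Num d.curve.formalInvariantDerivation (d.curve.clearedEval 1 (Polynomial.X - Polynomial.C (d.Y * th))) -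
        C d.T0 * X ^ 2 * d.curve.clearedEval 1 (Polynomial.X - Polynomial.C (d.Y * th)) ^ 2) * d.unitSeries ^ 2 := by
  set D : R[X] := Polynomial.X - Polynomial.C (d.Y * th) with hD
  have hDn : D.natDegree ≤ 1 := by
    rw [hD]; refine (Polynomial.natDegree_sub_le _ _).trans (max_le Polynomial.natDegree_X_le ?_)
    rw [Polynomial.natDegree_C]; exact Nat.zero_le _
  -- `U = Y⁻²Ũ = (3X - T₀)D² - 𝓛(D)`
  have hY2 : d.yi ^ 2 * d.Y ^ 2 = 1 := by linear_combination (d.Y * d.yi + 1) * d.Y_mul_yi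
  have hU : d.xNum = (Polynomial.C (((2 * 1 + 1 : ℕ) : R)) * Polynomial.X - Polynomial.C d.T0) * D ^ 2 -
      d.curve.veluLogOp D := by
    rw [xNum, d.kohel h3, ← mul_assoc, ← Polynomial.C_mul, hY2, Polynomial.C_1, one_mul, ← hD]
    norm_num
  have hevU := d.curve.clearedEval_logForm (n := 1) le_rfl hDn hU
  rw [formalXMulSq_isogCurve_subst, hevU]
  push_cast
  ring

/-- **Blakestad–Grant's Prop. 13 hypothesis in `ρ`-form for the canonical `3`-isogeny**:
`(π²·ρ'(T) - 3·ρ + T₀)·u² = u·D²u - (Du)²` (`ρ = x + D(Dz/z)` the regular part of `x`, tree `formalXReg`) —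
by the tree's `formalXReg_rel_of_velu` from `T = πtNu`, `ω'(T)dT = πω` and the Vélu form of `X'(T)`.
This is the input of `zetaTilde_isogeny_rel_of_formalXReg_rel` (Prop. 13(a)) and hence of Dwork's lemma
(`coeff_exp_sigmaExpArg_mem_of_isogeny`). [cite: BlakestadGrant2023, Prop. 13] -/
theorem formalXReg_rel :
    (C (d.piConst ^ 2) * d.isogCurve.formalXReg.subst d.isogParam - (3 : R⟦X⟧) * d.curve.formalXReg + C d.T0) *
        d.unitSeries ^ 2 = logDeriv₂Num d.curve.formalInvariantDerivation d.unitSeries := by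
  have hN0 : constantCoeff (d.curve.clearedEval 1 (Polynomial.X - Polynomial.C (d.Y * th))) = 1 := by
    have hDn : (Polynomial.X - Polynomial.C (d.Y * th) : R[X]).natDegree ≤ 1 := by
      refine (Polynomial.natDegree_sub_le _ _).trans (max_le Polynomial.natDegree_X_le ?_)
      rw [Polynomial.natDegree_C]; exact Nat.zero_le _
    rw [d.curve.constantCoeff_clearedEval hDn, Polynomial.coeff_sub, Polynomial.coeff_X_one, Polynomial.coeff_C,
      if_neg one_ne_zero, sub_zero]
  have h := WeierstrassCurve.formalXReg_rel_of_velu (W := d.curve) (W' := d.isogCurve) 3 (d.isUnit_piConst h3) hN0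
    d.constantCoeff_unitSeries (d.isogParam_eq h3) (d.formalInvDiff_isogCurve_subst h3)
    (d.formalXMulSq_isogCurve_subst_eq_logForm h3)
  exact_mod_cast h

end Third

end Chart

end Literature.NumberTheory.EllipticCurves.PadicSigmaThree

end

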